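import Literature.MathematicalPhysics.QuantumFieldTheory.Balaban1983to89.B9Thm31SiteGsqDecayReg335Y
import Literature.MathematicalPhysics.QuantumFieldTheory.Balaban1983to89.B9Thm31SiteGpGradWeightedReg335Y
import Literature.MathematicalPhysics.QuantumFieldTheory.Balaban1983to89.B9Thm31SiteGpDivDecayReg335Y

/-!
# `Balaban1983to89.B9Thm31SiteGsqGradDecayReg335Y` — T. Bałaban, *Propagators for lattice gauge theories in a background field*, Commun. Math. Phys.
# **99** (1985) 389–434 [Balaban1985BackgroundPropagators] Cor 3.6 p. 408 ∕ Thm 3.1 (3.46)–(3.47) p. 398 ∕ (3.79) p. 406, by S. Agmon's positive-weight method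
# [Agmon1982]: ★★★ **COROLLARY 3.6's GRADIENT MEMBERS (3.46b) `∇_UG′_□` AND (3.46e) `∇_UG′_□∇*_U` IN `L²` FOR THE GENUINE LOCAL CUBE INVERSES
# `G′_□(U) = GsqY i (parSymY i) D U`, UNIFORMLY IN □** — files 8 ∕ 13 of this seat VERBATIM for every Dirichlet compression (file 21 of the site-sector set of
# width seat `pub-ymgap-dag-n06-w1`; file 20 = `B9Thm31SiteGsqDecayReg335Y` is (3.46a); file 22 = (3.46c) + the cut-off–sandwiched mixed member)

statement-level skeleton of published theorems with citation tags; proofs where landed; nothing here is a claim about the Yang–Mills mass gap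

THE PRINT (verbatim).  p. 408, Cor 3.6: *«the operators `G′_□`, `G_□` … satisfy the inequalities (3.42)–(3.47) with constants independent of □»*; p. 398,
(3.46): *«… ‖h∇_UG′(U)λ‖, ‖hG′(U)∇\*_Uλ‖, …, ‖h∇_UG′(U)∇\*_Uλ‖, … ≦ B₀[(Lʲη)², Lʲη, Lʲη, 1, 1, 1]|h|e^{−δ₀d(y,y′)}‖λ‖»*; p. 398 after (3.47): *«we may always
replace ∇_U by ∇\*_U, and vice versa»*.

WHY THIS FILE (cell `pub-ymgap`, Track A node N06 [B9], width seat `pub-ymgap-dag-n06-w1`, gen 3).  Row 18's walk displays the MIXED `L²` member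
`∇_ν (h_□G′_□h_□) ∇*_μ` (`L2MixedLegs37.lm`, dag-n06-k) at the cube operators, which W-a pins to def-Y's genuine `GsqY`; its inputs are the three gradient
members of (3.46) for `G′_□` with □-free constants.  Files 8∕13 proved (3.46b)∕(3.46e) for `G′(U) = GpY` (= `GsqY … univ`); THIS FILE proves them for
EVERY `D` with the SAME constants (160·(L^{j_B})²∕W², 10∕W²), by the same energy∕Agmon bookkeeping — the two new inputs being file 20's
`conj_wsmul_GsqY_eq_pairing` and `trIP_GsqY_deltaPrimeAY_GsqY` (`⟨G′_□Ψ, Δ′_aG′_□Ψ⟩ = ⟨G′_□Ψ, Ψ⟩`, replacing `Δ′_aG′Ψ = Ψ`).  ((3.46c) `G′_□∇*_U`, by duality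
and in the forward weight orientation, is file 22 `B9Thm31SiteGsqCutoffMixedReg335Y`.)

WHAT IS PROVED (sorry-free; 0 `def`).  On the class `(bg9K (M_N ℂ) G i).Reg335 c α₀`, `N ≥ 1`, `0 ≤ c·M·α₀`, `c·M·α₀·(d+1) ≤ 1∕16`, every site set `D`,
weights as in files 6∕8 (or the canonical `e^{δ₀ρ}`, `δ₀ = 1∕(4(d+2))`):
* §G1 (3.46b): ★★★ `hs_restrict_cdS_GsqY_parSymY_le` (`Σ_{z∈A}Σ_μ HS((∇_{U,μ}G′_□(U)Ψ)(z)) ≤ 160·((L^{j_B})²∕W²)·‖Ψ‖²₁`), ★★ `…_exp_canonical`.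
* §G3 (3.46e): ★ `trIP_GsqY_cdsS_cdsS_le` (`⟨G′_□∇*_μλ, ∇*_μλ⟩ ≤ ‖λ‖²`), ★★ `sum_trIP_cdS_GsqY_cdsS_le` (`Σ_ν‖∇_νG′_□∇*_μλ‖² ≤ ‖λ‖²` at EVERY `G`-valued `U`, no smallness), `trIP_cdS_GsqY_cdsS_le`,
  ★★★ `hs_restrict_cdS_GsqY_cdsS_le` (`Σ_{z∈A}Σ_ν HS((∇_νG′_□∇*_μλ)(z)) ≤ 10·‖λ‖²₁∕W²`), ★★ `…_exp_canonical`.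
MODEL ∕ DECLARED READINGS.  As files 8∕9∕13∕19∕20.  NOT HERE: the cut-offs `h_□` inside the legs (Leibniz with `|∇h_□|`, a separate assembly), the
second-order member `h G′_□ h ∇*∇*` (`L2SecondLegs37.l5`; needs a lattice Bochner identity), the Laplacian members, the sup-norm (3.42), the bond sector.
NON-VACUITY (A6): as file 20.
HONEST SCOPE.  Energy∕Agmon bookkeeping over landed estimates, constants explicit; NOT a node discharge, NOT summit progress; count-neutral; nothing
continuum ∕ OS ∕ mass gap ∕ Clay.  NEW file importing file 20 and files 9∕16 (for their generic lemmas `sum_wsq_hs_cdS_le`, `sum_trIP_cdS_le_trIP_deltaPrimeAY`,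
`hs_wsmul_cdS_le`, `grad_arith`, `graddiv_arith`) only; nothing landed is modified.  Net new unproved facts: 0.
-/

noncomputable section

namespace Literature.MathematicalPhysics.QuantumFieldTheory.Balaban1983to89.B9Thm31SiteGsqGradDecayReg335Y

open Literature.MathematicalPhysics.QuantumFieldTheory.Balaban1983to89
open Node00 B6KLevelCensusIndexV1 B6Geom246MultiLevelBox B6MultiLevelBoxOperator B6MultiLevelTorusOperator B6GlobalChartV1 B9BackgroundsKLevelV1
  B9Eq39Adjoint B9Thm311ReadingCoords B9Thm311DeltaPrimePos B9Ineq369CurvatureSmallAtLettersY B9Thm31SiteCoerciveGaugeBlockY B9Thm31SiteCoerciveReg335Y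
  B9Thm31SiteGpBoundsReg335Y B9Thm31SitePolarisedFormY B9Thm31SiteConjugatedFormY B9Thm31SiteGpDecayReg335Y B9Thm31SiteAgmonWeightY
  B9Thm31SiteGpGradDecayReg335Y B9Thm31SiteGpDivDecayReg335Y B9Thm31SiteGradGpDivDecayReg335Y Node00.OpsYLocalInverse B9Thm311LocalInversePosY
  B9Thm31SiteGsqBoundsReg335Y B9Thm31SiteGsqDecayReg335Y
open Literature.MathematicalPhysics.QuantumFieldTheory.Balaban1983to89.B9Ineq349SiteAdjoint (trIP_comm trIP_cdS_left)
open Literature.MathematicalPhysics.QuantumFieldTheory.Balaban1983to89.B9Thm311FlippedBondLetters (hs_real_smul)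
open scoped Matrix Matrix.Norms.L2Operator

variable {d ℓ : ℕ} {hd : 1 ≤ d + 1} {hL : Odd (ℓ + 1) ∧ 1 < ℓ + 1} {b₀ b₁ : ℝ}
variable (i : KIdx d ℓ hd hL b₀ b₁) {N : ℕ} {G : Subgroup (Matrix (Fin N) (Fin N) ℂ)ˣ}

/-! ## §G1 (3.46b) for `G′_□(U)` -/

/-- ★★★ **THE `L²`-LOCAL DECAY OF `∇_U G′_□(U)` ON THE CLASS (3.35) — (3.46b)'s SHAPE BY AGMON'S METHOD.**  Hypotheses as `hs_restrict_GsqY_parSymY_le`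
(class, weight `ω` with `ω = 1` on `B ⊇ supp Ψ`, `ω ≥ W > 0` on `A`, bond ratios `q ≤ θ_b·(L^{lev})⁻²` at both ends, block oscillation `q ≤ θ_s`,
`(d+1)θ_b + θ_s∕2 ≤ 1∕16`, levels `≤ j_B` on `B`) plus `0 ≤ θ_b`, `0 ≤ θ_s`.  THEN `Σ_{z∈A}Σ_μ HS((∇_{U,μ}G′_□(U)Ψ)(z)) ≤ 160·((L^{j_B})²∕W²)·‖Ψ‖²₁` — NO factor
`(L^{j_A})²`, as in print. [cite: Balaban1985BackgroundPropagators, Cor 3.6 p.408, Thm 3.1 (3.46) p.398, (3.79) p.406, (3.35) p.396; Agmon1982, Ch.1, Thm 1.5] -/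
theorem hs_restrict_cdS_GsqY_parSymY_le [Nonempty (Fin N)] (hG : G ≤ B7Prop2Explicit.unitaryUnits (Matrix (Fin N) (Fin N) ℂ))
    {U : CfgY (Matrix (Fin N) (Fin N) ℂ) i} {c α₀ : ℝ} (hC0 : 0 ≤ c * (kGeo i).M * α₀) (hC1 : c * (kGeo i).M * α₀ * ((d : ℝ) + 1) ≤ 1 / 16)
    (hreg : (bg9K (Matrix (Fin N) (Fin N) ℂ) G i).Reg335 c α₀ U) (D : Finset (SiteY i)) {ω : SiteY i → ℝ} (hω : ∀ z, 0 < ω z) {θb θs : ℝ} (hθb0 : 0 ≤ θb) (hθs0 : 0 ≤ θs)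
    (hb1 : ∀ μ z, ω (shiftY i μ z) / ω z + ω z / ω (shiftY i μ z) - 2 ≤ θb * (((((ℓ + 1) ^ (blkOf i.D.toDomains z).1.1 : ℕ) : ℝ)) ^ 2)⁻¹)
    (hb2 : ∀ μ z, ω (shiftY i μ z) / ω z + ω z / ω (shiftY i μ z) - 2 ≤ θb * (((((ℓ + 1) ^ (blkOf i.D.toDomains (shiftY i μ z)).1.1 : ℕ) : ℝ)) ^ 2)⁻¹)
    (hs : ∀ z w : SiteY i, blkOf i.D.toDomains w = blkOf i.D.toDomains z → ω z / ω w + ω w / ω z - 2 ≤ θs)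
    (hκ : ((d : ℝ) + 1) * θb + θs / 2 ≤ 1 / 16)
    {A B : Finset (SiteY i)} {Ψ : SiteY i → Matrix (Fin N) (Fin N) ℂ} (hΨ : ∀ z, z ∉ B → Ψ z = 0) (hωB : ∀ z ∈ B, ω z = 1)
    {jB : ℕ} (hjB : ∀ z ∈ B, (blkOf i.D.toDomains z).1.1 ≤ jB) {W : ℝ} (hW0 : 0 < W) (hW : ∀ z ∈ A, W ≤ ω z) :
    ∑ z ∈ A, ∑ μ : Fin (d + 1), ∑ a, ∑ b, ‖cdS i U μ (GsqY i (parSymY i) D U Ψ) z a b‖ ^ 2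
      ≤ 160 * (((((ℓ + 1) ^ jB : ℕ) : ℝ)) ^ 2 / W ^ 2) * trIP (fun _ => (1 : ℝ)) Ψ Ψ := by
  have hU : ∀ μ x, U μ x ∈ G := hreg.1
  have hθ : ((d : ℝ) + 1) * θb ≤ 1 / 16 := by linarith
  have hm1 : ∀ z : SiteY i, (((((ℓ + 1) ^ (blkOf i.D.toDomains z).1.1 : ℕ) : ℝ)) ^ 2)⁻¹ ≤ 1 := fun z => by
    have h1 : (1 : ℝ) ≤ (((ℓ + 1) ^ (blkOf i.D.toDomains z).1.1 : ℕ) : ℝ) := by exact_mod_cast Nat.one_le_pow _ _ (Nat.succ_pos ℓ)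
    exact inv_le_one_of_one_le₀ (by nlinarith)
  have hM0 : 0 ≤ ∑ z : SiteY i, (((((ℓ + 1) ^ (blkOf i.D.toDomains z).1.1 : ℕ) : ℝ)) ^ 2)⁻¹ * ∑ a, ∑ b, ‖(((ω z : ℝ) : ℂ) • GsqY i (parSymY i) D U Ψ z) a b‖ ^ 2 :=
    Finset.sum_nonneg fun z _ => mul_nonneg (inv_nonneg.2 (by positivity)) (hs_nonneg _)
  -- Agmon's two readings (file 6)
  have hiX := levelMass_wsmul_GsqY_le_pairing i hG hC0 hC1 hreg D hω hb1 hb2 hs hΨ hωB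
  have hXQ := pairing_GsqY_le_of_support i hG hC0 hC1 hreg D hω hb1 hb2 hs hκ hΨ hωB hjB
  -- the energy of the weighted field: `E ≤ ⟨Φ′, Δ′Φ′⟩ ≤ conj + κM = X + κM`
  have hE : ∑ μ : Fin (d + 1), trIP (fun _ => (1 : ℝ)) (cdS i U μ (fun w => ((ω w : ℝ) : ℂ) • GsqY i (parSymY i) D U Ψ w))
        (cdS i U μ (fun w => ((ω w : ℝ) : ℂ) • GsqY i (parSymY i) D U Ψ w))
      ≤ trIP (fun _ => (1 : ℝ)) (GsqY i (parSymY i) D U Ψ) Ψ + (((d : ℝ) + 1) * θb + θs / 2) *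
          ∑ z : SiteY i, (((((ℓ + 1) ^ (blkOf i.D.toDomains z).1.1 : ℕ) : ℝ)) ^ 2)⁻¹ * ∑ a, ∑ b, ‖(((ω z : ℝ) : ℂ) • GsqY i (parSymY i) D U Ψ z) a b‖ ^ 2 := by
    have h1 := sum_trIP_cdS_le_trIP_deltaPrimeAY i hG (parSymY i) U (parSymY_inv_symm U) (fun z w => parSymY_mem i hU z w) hU
      (fun w => ((ω w : ℝ) : ℂ) • GsqY i (parSymY i) D U Ψ w)
    have h2 := trIP_wsmul_deltaPrimeAY_winv_ge i hG (parSymY i) U (parSymY_inv_symm U) (fun z w => parSymY_mem i hU z w) hU hω hb1 hb2 hs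
      (fun w => ((ω w : ℝ) : ℂ) • GsqY i (parSymY i) D U Ψ w)
    rw [conj_wsmul_GsqY_eq_pairing i hG hU D hω hΨ hωB] at h2
    linarith
  -- the per-bond algebra, summed: `Σ_zΣ_μ ω_z²HS(∇Φ z) ≤ 2E + 6(d+1)θ_b M`
  have hdef : ∀ μ z, (ω (shiftY i μ z) - ω z) ^ 2 * ∑ a, ∑ b, ‖GsqY i (parSymY i) D U Ψ (shiftY i μ z) a b‖ ^ 2
      ≤ 3 * θb * ((((((ℓ + 1) ^ (blkOf i.D.toDomains (shiftY i μ z)).1.1 : ℕ) : ℝ)) ^ 2)⁻¹ *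
          ∑ a, ∑ b, ‖(((ω (shiftY i μ z) : ℝ) : ℂ) • GsqY i (parSymY i) D U Ψ (shiftY i μ z)) a b‖ ^ 2) := by
    intro μ z
    have hθm : θb * (((((ℓ + 1) ^ (blkOf i.D.toDomains (shiftY i μ z)).1.1 : ℕ) : ℝ)) ^ 2)⁻¹ ≤ 1 := by
      have hd1 : θb ≤ 1 / 16 := by
        have : (0 : ℝ) ≤ d := Nat.cast_nonneg d
        nlinarith
      have h0 : (0 : ℝ) ≤ (((((ℓ + 1) ^ (blkOf i.D.toDomains (shiftY i μ z)).1.1 : ℕ) : ℝ)) ^ 2)⁻¹ := inv_nonneg.2 (by positivity)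
      nlinarith [hm1 (shiftY i μ z)]
    have h := sq_sub_le_of_q_le (hω (shiftY i μ z)) (hω z) (hb2 μ z) hθm
    rw [hs_real_smul]
    have hX' := hs_nonneg (GsqY i (parSymY i) D U Ψ (shiftY i μ z))
    calc (ω (shiftY i μ z) - ω z) ^ 2 * ∑ a, ∑ b, ‖GsqY i (parSymY i) D U Ψ (shiftY i μ z) a b‖ ^ 2
        ≤ (3 * (θb * (((((ℓ + 1) ^ (blkOf i.D.toDomains (shiftY i μ z)).1.1 : ℕ) : ℝ)) ^ 2)⁻¹) * ω (shiftY i μ z) ^ 2) *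
            ∑ a, ∑ b, ‖GsqY i (parSymY i) D U Ψ (shiftY i μ z) a b‖ ^ 2 := mul_le_mul_of_nonneg_right h hX'
      _ = _ := by ring
  have hsum : ∑ z : SiteY i, ∑ μ : Fin (d + 1), ω z ^ 2 * ∑ a, ∑ b, ‖cdS i U μ (GsqY i (parSymY i) D U Ψ) z a b‖ ^ 2
      ≤ 2 * ∑ μ : Fin (d + 1), trIP (fun _ => (1 : ℝ)) (cdS i U μ (fun w => ((ω w : ℝ) : ℂ) • GsqY i (parSymY i) D U Ψ w))
            (cdS i U μ (fun w => ((ω w : ℝ) : ℂ) • GsqY i (parSymY i) D U Ψ w))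
        + 6 * (((d : ℝ) + 1) * θb) *
          ∑ z : SiteY i, (((((ℓ + 1) ^ (blkOf i.D.toDomains z).1.1 : ℕ) : ℝ)) ^ 2)⁻¹ * ∑ a, ∑ b, ‖(((ω z : ℝ) : ℂ) • GsqY i (parSymY i) D U Ψ z) a b‖ ^ 2 := by
    rw [Finset.sum_comm]
    have hμ : ∀ μ : Fin (d + 1), ∑ z : SiteY i, ω z ^ 2 * ∑ a, ∑ b, ‖cdS i U μ (GsqY i (parSymY i) D U Ψ) z a b‖ ^ 2
        ≤ 2 * trIP (fun _ => (1 : ℝ)) (cdS i U μ (fun w => ((ω w : ℝ) : ℂ) • GsqY i (parSymY i) D U Ψ w))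
            (cdS i U μ (fun w => ((ω w : ℝ) : ℂ) • GsqY i (parSymY i) D U Ψ w))
          + 6 * θb * ∑ z : SiteY i, (((((ℓ + 1) ^ (blkOf i.D.toDomains z).1.1 : ℕ) : ℝ)) ^ 2)⁻¹ *
              ∑ a, ∑ b, ‖(((ω z : ℝ) : ℂ) • GsqY i (parSymY i) D U Ψ z) a b‖ ^ 2 := by
      intro μ
      have hz : ∀ z, ω z ^ 2 * ∑ a, ∑ b, ‖cdS i U μ (GsqY i (parSymY i) D U Ψ) z a b‖ ^ 2
          ≤ 2 * ∑ a, ∑ b, ‖cdS i U μ (fun w => ((ω w : ℝ) : ℂ) • GsqY i (parSymY i) D U Ψ w) z a b‖ ^ 2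
            + 2 * (3 * θb * ((((((ℓ + 1) ^ (blkOf i.D.toDomains (shiftY i μ z)).1.1 : ℕ) : ℝ)) ^ 2)⁻¹ *
                ∑ a, ∑ b, ‖(((ω (shiftY i μ z) : ℝ) : ℂ) • GsqY i (parSymY i) D U Ψ (shiftY i μ z)) a b‖ ^ 2)) := by
        intro z
        have h1 := hs_wsmul_cdS_le i hG hU μ ω (GsqY i (parSymY i) D U Ψ) z
        have h2 := hdef μ z
        linarith
      refine (Finset.sum_le_sum fun z _ => hz z).trans (le_of_eq ?_)
      rw [Finset.sum_add_distrib, ← Finset.mul_sum, ← Finset.mul_sum, trIP_one_self_eq,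
        Equiv.sum_comp (shiftY i μ) (fun z => 3 * θb * ((((((ℓ + 1) ^ (blkOf i.D.toDomains z).1.1 : ℕ) : ℝ)) ^ 2)⁻¹ *
          ∑ a, ∑ b, ‖(((ω z : ℝ) : ℂ) • GsqY i (parSymY i) D U Ψ z) a b‖ ^ 2)), ← Finset.mul_sum]
      ring
    calc ∑ μ : Fin (d + 1), ∑ z : SiteY i, ω z ^ 2 * ∑ a, ∑ b, ‖cdS i U μ (GsqY i (parSymY i) D U Ψ) z a b‖ ^ 2
        ≤ ∑ μ : Fin (d + 1), (2 * trIP (fun _ => (1 : ℝ)) (cdS i U μ (fun w => ((ω w : ℝ) : ℂ) • GsqY i (parSymY i) D U Ψ w))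
              (cdS i U μ (fun w => ((ω w : ℝ) : ℂ) • GsqY i (parSymY i) D U Ψ w))
            + 6 * θb * ∑ z : SiteY i, (((((ℓ + 1) ^ (blkOf i.D.toDomains z).1.1 : ℕ) : ℝ)) ^ 2)⁻¹ *
                ∑ a, ∑ b, ‖(((ω z : ℝ) : ℂ) • GsqY i (parSymY i) D U Ψ z) a b‖ ^ 2) := Finset.sum_le_sum fun μ _ => hμ μ
      _ = _ := by
          rw [Finset.sum_add_distrib, ← Finset.mul_sum, Finset.sum_const, Finset.card_univ, Fintype.card_fin, nsmul_eq_mul]; push_cast; ring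
  -- restrict to `A`, where `ω ≥ W`
  have hPA : W ^ 2 * ∑ z ∈ A, ∑ μ : Fin (d + 1), ∑ a, ∑ b, ‖cdS i U μ (GsqY i (parSymY i) D U Ψ) z a b‖ ^ 2
      ≤ ∑ z : SiteY i, ∑ μ : Fin (d + 1), ω z ^ 2 * ∑ a, ∑ b, ‖cdS i U μ (GsqY i (parSymY i) D U Ψ) z a b‖ ^ 2 := by
    rw [Finset.mul_sum]
    have hterm : ∀ z, 0 ≤ ∑ μ : Fin (d + 1), ω z ^ 2 * ∑ a, ∑ b, ‖cdS i U μ (GsqY i (parSymY i) D U Ψ) z a b‖ ^ 2 :=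
      fun z => Finset.sum_nonneg fun μ _ => mul_nonneg (sq_nonneg _) (hs_nonneg _)
    refine le_trans (Finset.sum_le_sum fun z hz => ?_) (Finset.sum_le_univ_sum_of_nonneg hterm)
    rw [Finset.mul_sum]
    exact Finset.sum_le_sum fun μ _ => mul_le_mul_of_nonneg_right (pow_le_pow_left₀ hW0.le (hW z hz) 2) (hs_nonneg _)
  exact grad_arith hE hsum hPA hκ hθ hiX hXQ hM0 hW0 (by positivity)

/-- ★★★ **(3.46b) WITH THE CANONICAL AGMON WEIGHT**: `ρ` with `|ρ(z+e_μ) − ρ z| ≤ (L^{lev})⁻¹` at both ends of every bond, `|ρ z − ρ w| ≤ d+1` on every block of `𝔅`,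
`ρ = 0` on `B ⊇ supp Ψ`, `ρ ≥ r` on `A`, levels `≤ j_B` on `B`, `δ₀ = 1∕(4(d+2))`: `Σ_{z∈A}Σ_μ HS((∇_{U,μ}G′_□(U)Ψ)(z)) ≤ 160·((L^{j_B})²∕(e^{δ₀r})²)·‖Ψ‖²₁` on the
class. [cite: Balaban1985BackgroundPropagators, Cor 3.6 p.408, Thm 3.1 (3.46) p.398, (3.79) p.406; Agmon1982, Ch.1, Thm 1.5] -/
theorem hs_restrict_cdS_GsqY_parSymY_le_exp_canonical [Nonempty (Fin N)] (hG : G ≤ B7Prop2Explicit.unitaryUnits (Matrix (Fin N) (Fin N) ℂ))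
    {U : CfgY (Matrix (Fin N) (Fin N) ℂ) i} {c α₀ : ℝ} (hC0 : 0 ≤ c * (kGeo i).M * α₀) (hC1 : c * (kGeo i).M * α₀ * ((d : ℝ) + 1) ≤ 1 / 16)
    (hreg : (bg9K (Matrix (Fin N) (Fin N) ℂ) G i).Reg335 c α₀ U) (D : Finset (SiteY i)) {ρ : SiteY i → ℝ}
    (hρ1 : ∀ μ z, |ρ (shiftY i μ z) - ρ z| ≤ ((((ℓ + 1) ^ (blkOf i.D.toDomains z).1.1 : ℕ) : ℝ))⁻¹)
    (hρ2 : ∀ μ z, |ρ (shiftY i μ z) - ρ z| ≤ ((((ℓ + 1) ^ (blkOf i.D.toDomains (shiftY i μ z)).1.1 : ℕ) : ℝ))⁻¹)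
    (hρD : ∀ z w : SiteY i, blkOf i.D.toDomains w = blkOf i.D.toDomains z → |ρ z - ρ w| ≤ (d : ℝ) + 1)
    {A B : Finset (SiteY i)} {Ψ : SiteY i → Matrix (Fin N) (Fin N) ℂ} (hΨ : ∀ z, z ∉ B → Ψ z = 0) (hρB : ∀ z ∈ B, ρ z = 0)
    {jB : ℕ} (hjB : ∀ z ∈ B, (blkOf i.D.toDomains z).1.1 ≤ jB) {r : ℝ} (hr : ∀ z ∈ A, r ≤ ρ z) :
    ∑ z ∈ A, ∑ μ : Fin (d + 1), ∑ a, ∑ b, ‖cdS i U μ (GsqY i (parSymY i) D U Ψ) z a b‖ ^ 2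
      ≤ 160 * (((((ℓ + 1) ^ jB : ℕ) : ℝ)) ^ 2 / Real.exp ((1 / (4 * ((d : ℝ) + 2))) * r) ^ 2) * trIP (fun _ => (1 : ℝ)) Ψ Ψ := by
  have hd0 : (0 : ℝ) ≤ d := Nat.cast_nonneg d
  have hd2 : (0 : ℝ) < 4 * ((d : ℝ) + 2) := by positivity
  have hδ0 : (0 : ℝ) ≤ 1 / (4 * ((d : ℝ) + 2)) := by positivity
  have hδ1 : 1 / (4 * ((d : ℝ) + 2)) ≤ 1 := by rw [div_le_one hd2]; linarith
  have hδD : 1 / (4 * ((d : ℝ) + 2)) * ((d : ℝ) + 1) ≤ 1 := by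
    rw [div_mul_eq_mul_div, one_mul, div_le_one hd2]; linarith
  have hδκ0 : (1 / (4 * ((d : ℝ) + 2))) ^ 2 * (2 * ((d : ℝ) + 1) + ((d : ℝ) + 1) ^ 2) ≤ 1 / 16 := by
    rw [div_pow, one_pow, mul_pow, one_div_mul_eq_div, div_le_iff₀ (by positivity)]
    nlinarith
  have hδκ : ((d : ℝ) + 1) * (2 * (1 / (4 * ((d : ℝ) + 2))) ^ 2) + (2 * (1 / (4 * ((d : ℝ) + 2))) ^ 2 * ((d : ℝ) + 1) ^ 2) / 2 ≤ 1 / 16 := by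
    have e : ((d : ℝ) + 1) * (2 * (1 / (4 * ((d : ℝ) + 2))) ^ 2) + (2 * (1 / (4 * ((d : ℝ) + 2))) ^ 2 * ((d : ℝ) + 1) ^ 2) / 2
        = (1 / (4 * ((d : ℝ) + 2))) ^ 2 * (2 * ((d : ℝ) + 1) + ((d : ℝ) + 1) ^ 2) := by ring
    rw [e]; exact hδκ0
  have hω : ∀ z, 0 < Real.exp (1 / (4 * ((d : ℝ) + 2)) * ρ z) := fun z => Real.exp_pos _
  have hωB : ∀ z ∈ B, Real.exp (1 / (4 * ((d : ℝ) + 2)) * ρ z) = 1 := fun z hz => by rw [hρB z hz, mul_zero, Real.exp_zero]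
  have hW : ∀ z ∈ A, Real.exp (1 / (4 * ((d : ℝ) + 2)) * r) ≤ Real.exp (1 / (4 * ((d : ℝ) + 2)) * ρ z) :=
    fun z hz => Real.exp_le_exp.2 (mul_le_mul_of_nonneg_left (hr z hz) hδ0)
  exact hs_restrict_cdS_GsqY_parSymY_le i hG hC0 hC1 hreg D hω (by positivity) (by positivity)
    (fun μ z => bondRatio_exp_le i hδ0 hδ1 μ z (hρ1 μ z)) (fun μ z => bondRatio_exp_le' i hδ0 hδ1 μ z (hρ2 μ z))
    (fun z w hzw => blockOsc_exp_le i hδ0 hδD z w (hρD z w hzw)) hδκ hΨ hωB hjB (Real.exp_pos _) hW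

/-! ## §G3 (3.46e) for `G′_□(U)` -/

/-- ★★★ **`Σ_ν ‖∇_{U,ν}G′_□(U)∇\*_{U,μ}λ‖²₁ ≤ ‖λ‖²₁` AT EVERY `G`-VALUED BACKGROUND**, `G ≤ U(N)` (no smallness): the energy of `Φ = G′∇\*λ` is `⟨Φ, Δ′_aΦ⟩ = ⟨∇Φ, λ⟩`,
Cauchy–Schwarz closes. [cite: Balaban1985BackgroundPropagators, Cor 3.6 p.408, Thm 3.1 (3.47) p.398, (3.79) p.406 (|∇_UG′∇\*_Uλ| ≤ B₀|λ|), (3.8) p.392, (3.24) p.394] -/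
theorem sum_trIP_cdS_GsqY_cdsS_le (hG : G ≤ B7Prop2Explicit.unitaryUnits (Matrix (Fin N) (Fin N) ℂ)) {U : CfgY (Matrix (Fin N) (Fin N) ℂ) i}
    (hU : ∀ μ x, U μ x ∈ G) (D : Finset (SiteY i)) (μ : Fin (d + 1)) (Λ : SiteY i → Matrix (Fin N) (Fin N) ℂ) :
    ∑ ν : Fin (d + 1), trIP (fun _ => (1 : ℝ)) (cdS i U ν (GsqY i (parSymY i) D U (cdsS i U μ Λ))) (cdS i U ν (GsqY i (parSymY i) D U (cdsS i U μ Λ)))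
      ≤ trIP (fun _ => (1 : ℝ)) Λ Λ := by
  set Φ := GsqY i (parSymY i) D U (cdsS i U μ Λ) with hΦ
  set E := ∑ ν : Fin (d + 1), trIP (fun _ => (1 : ℝ)) (cdS i U ν Φ) (cdS i U ν Φ) with hE
  have hΔΦ : trIP (fun _ => (1 : ℝ)) Φ (deltaPrimeAY i (parSymY i) U Φ) = trIP (fun _ => (1 : ℝ)) Φ (cdsS i U μ Λ) :=
    trIP_GsqY_deltaPrimeAY_GsqY i hG hU D (cdsS i U μ Λ)
  have hE0 : 0 ≤ E := Finset.sum_nonneg fun _ _ => trIP_self_nonneg _ (fun _ => one_pos) _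
  have hQ0 : 0 ≤ trIP (fun _ => (1 : ℝ)) Λ Λ := trIP_self_nonneg _ (fun _ => one_pos) Λ
  -- `E ≤ ⟨Φ, Δ′Φ⟩ = ⟨Φ, ∇*λ⟩ = ⟨∇_μΦ, λ⟩`
  have h1 : E ≤ trIP (fun _ => (1 : ℝ)) (cdS i U μ Φ) Λ := by
    have h := sum_trIP_cdS_le_trIP_deltaPrimeAY i hG (parSymY i) U (parSymY_inv_symm U) (fun z w => parSymY_mem i hU z w) hU Φ
    rw [hΔΦ, ← trIP_cdS_left i (fun μ x => hG (hU μ x)) μ Φ Λ] at h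
    exact h
  -- Cauchy–Schwarz and `‖∇_μΦ‖² ≤ E`
  have h2 : trIP (fun _ => (1 : ℝ)) (cdS i U μ Φ) Λ ^ 2 ≤ E * trIP (fun _ => (1 : ℝ)) Λ Λ := by
    have hcs := trIP_sq_le (fun _ => (1 : ℝ)) (fun _ => one_pos) (cdS i U μ Φ) Λ
    have hμ : trIP (fun _ => (1 : ℝ)) (cdS i U μ Φ) (cdS i U μ Φ) ≤ E :=
      Finset.single_le_sum (f := fun ν => trIP (fun _ => (1 : ℝ)) (cdS i U ν Φ) (cdS i U ν Φ)) (fun _ _ => trIP_self_nonneg _ (fun _ => one_pos) _)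
        (Finset.mem_univ μ)
    exact hcs.trans (mul_le_mul_of_nonneg_right hμ hQ0)
  have h3 : E ^ 2 ≤ E * trIP (fun _ => (1 : ℝ)) Λ Λ := (pow_le_pow_left₀ hE0 h1 2).trans h2
  rcases hE0.eq_or_lt with h0 | hpos
  · rw [← h0]; exact hQ0
  · have h4 : E * E ≤ trIP (fun _ => (1 : ℝ)) Λ Λ * E := by nlinarith
    exact le_of_mul_le_mul_right h4 hpos

/-- ★★ one direction: `‖∇_{U,ν}G′_□(U)∇\*_{U,μ}λ‖²₁ ≤ ‖λ‖²₁` at every `G`-valued background. [cite: Balaban1985BackgroundPropagators, Cor 3.6 p.408, Thm 3.1 (3.47) p.398, (3.79) p.406] -/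
theorem trIP_cdS_GsqY_cdsS_le (hG : G ≤ B7Prop2Explicit.unitaryUnits (Matrix (Fin N) (Fin N) ℂ)) {U : CfgY (Matrix (Fin N) (Fin N) ℂ) i}
    (hU : ∀ μ x, U μ x ∈ G) (D : Finset (SiteY i)) (ν μ : Fin (d + 1)) (Λ : SiteY i → Matrix (Fin N) (Fin N) ℂ) :
    trIP (fun _ => (1 : ℝ)) (cdS i U ν (GsqY i (parSymY i) D U (cdsS i U μ Λ))) (cdS i U ν (GsqY i (parSymY i) D U (cdsS i U μ Λ))) ≤ trIP (fun _ => (1 : ℝ)) Λ Λ :=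
  le_trans (Finset.single_le_sum (f := fun ν => trIP (fun _ => (1 : ℝ)) (cdS i U ν (GsqY i (parSymY i) D U (cdsS i U μ Λ))) (cdS i U ν (GsqY i (parSymY i) D U (cdsS i U μ Λ))))
    (fun _ _ => trIP_self_nonneg _ (fun _ => one_pos) _) (Finset.mem_univ ν)) (sum_trIP_cdS_GsqY_cdsS_le i hG hU D μ Λ)

/-- ★ the energy bound behind (3.46c)∕(3.46e): `⟨G′_□(U)∇\*_{U,μ}λ, ∇\*_{U,μ}λ⟩₁ ≤ ‖λ‖²₁` at EVERY `G`-valued `U` (no smallness).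
[cite: Balaban1985BackgroundPropagators, Cor 3.6 p.408, Thm 3.1 (3.47) p.398, (3.8) p.392, (3.79) p.406] -/
theorem trIP_GsqY_cdsS_cdsS_le (hG : G ≤ B7Prop2Explicit.unitaryUnits (Matrix (Fin N) (Fin N) ℂ)) {U : CfgY (Matrix (Fin N) (Fin N) ℂ) i}
    (hU : ∀ μ x, U μ x ∈ G) (D : Finset (SiteY i)) (μ : Fin (d + 1)) (Λ : SiteY i → Matrix (Fin N) (Fin N) ℂ) :
    trIP (fun _ => (1 : ℝ)) (GsqY i (parSymY i) D U (cdsS i U μ Λ)) (cdsS i U μ Λ) ≤ trIP (fun _ => (1 : ℝ)) Λ Λ := by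
  set v := cdsS i U μ Λ with hvdef
  have hQ0 : 0 ≤ trIP (fun _ => (1 : ℝ)) Λ Λ := trIP_self_nonneg _ (fun _ => one_pos) Λ
  have hΔΦ := trIP_GsqY_deltaPrimeAY_GsqY i hG hU D v
  have hXeq : trIP (fun _ => (1 : ℝ)) (GsqY i (parSymY i) D U v) v = trIP (fun _ => (1 : ℝ)) (cdS i U μ (GsqY i (parSymY i) D U v)) Λ := by
    rw [hvdef, trIP_cdS_left i (fun μ x => hG (hU μ x)) μ]
  have hE0 : ∑ ν : Fin (d + 1), trIP (fun _ => (1 : ℝ)) (cdS i U ν (GsqY i (parSymY i) D U v)) (cdS i U ν (GsqY i (parSymY i) D U v))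
      ≤ trIP (fun _ => (1 : ℝ)) (GsqY i (parSymY i) D U v) v := by
    have h := sum_trIP_cdS_le_trIP_deltaPrimeAY i hG (parSymY i) U (parSymY_inv_symm U) (fun z w => parSymY_mem i hU z w) hU (GsqY i (parSymY i) D U v)
    rwa [hΔΦ] at h
  set X := trIP (fun _ => (1 : ℝ)) (GsqY i (parSymY i) D U v) v with hX
  have hX0 : 0 ≤ X := le_trans (Finset.sum_nonneg fun _ _ => trIP_self_nonneg _ (fun _ => one_pos) _) hE0
  have hcs := trIP_sq_le (fun _ => (1 : ℝ)) (fun _ => one_pos) (cdS i U μ (GsqY i (parSymY i) D U v)) Λ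
  have hμ : trIP (fun _ => (1 : ℝ)) (cdS i U μ (GsqY i (parSymY i) D U v)) (cdS i U μ (GsqY i (parSymY i) D U v)) ≤ X :=
    le_trans (Finset.single_le_sum (f := fun ν => trIP (fun _ => (1 : ℝ)) (cdS i U ν (GsqY i (parSymY i) D U v)) (cdS i U ν (GsqY i (parSymY i) D U v)))
      (fun _ _ => trIP_self_nonneg _ (fun _ => one_pos) _) (Finset.mem_univ μ)) hE0
  have h3 : X ^ 2 ≤ X * trIP (fun _ => (1 : ℝ)) Λ Λ := by
    rw [hXeq]; rw [hXeq] at hμ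
    exact hcs.trans (mul_le_mul_of_nonneg_right hμ hQ0)
  rcases hX0.eq_or_lt with h0 | hpos
  · rw [← h0]; exact hQ0
  · have h4 : X * X ≤ trIP (fun _ => (1 : ℝ)) Λ Λ * X := by nlinarith
    exact le_of_mul_le_mul_right h4 hpos

/-- ★★★ **THE `L²`-LOCAL DECAY OF `∇_U G′_□(U) ∇\*_U` ON THE CLASS (3.35)** — (3.46e)'s SHAPE, NO SCALE FACTOR.  `G ≤ U(N)`, `N ≥ 1`, `0 ≤ c·M·α₀`,
`c·M·α₀·(d+1) ≤ 1∕16`, `U ∈ Reg335 c α₀`; a weight `ω > 0` with `ω = 1` on `B ⊇ supp ∇\*_{U,μ}λ`, `ω ≥ W > 0` on `A`, bond ratios `q ≤ θ_b·(L^{lev})⁻²` (both ends),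
block oscillation `q ≤ θ_s`, `0 ≤ θ_b, θ_s`, `(d+1)θ_b + θ_s∕2 ≤ 1∕16`.  THEN `Σ_{z∈A}Σ_ν HS((∇_{U,ν}G′_□(U)∇\*_{U,μ}λ)(z)) ≤ 10·‖λ‖²₁∕W²`.
[cite: Balaban1985BackgroundPropagators, Cor 3.6 p.408, Thm 3.1 (3.46) p.398, (3.79) p.406, (3.35) p.396; Agmon1982, Ch.1, Thm 1.5] -/
theorem hs_restrict_cdS_GsqY_cdsS_le [Nonempty (Fin N)] (hG : G ≤ B7Prop2Explicit.unitaryUnits (Matrix (Fin N) (Fin N) ℂ))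
    {U : CfgY (Matrix (Fin N) (Fin N) ℂ) i} {c α₀ : ℝ} (hC0 : 0 ≤ c * (kGeo i).M * α₀) (hC1 : c * (kGeo i).M * α₀ * ((d : ℝ) + 1) ≤ 1 / 16)
    (hreg : (bg9K (Matrix (Fin N) (Fin N) ℂ) G i).Reg335 c α₀ U) (D : Finset (SiteY i)) {ω : SiteY i → ℝ} (hω : ∀ z, 0 < ω z) {θb θs : ℝ} (hθb0 : 0 ≤ θb) (hθs0 : 0 ≤ θs)
    (hb1 : ∀ μ z, ω (shiftY i μ z) / ω z + ω z / ω (shiftY i μ z) - 2 ≤ θb * (((((ℓ + 1) ^ (blkOf i.D.toDomains z).1.1 : ℕ) : ℝ)) ^ 2)⁻¹)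
    (hb2 : ∀ μ z, ω (shiftY i μ z) / ω z + ω z / ω (shiftY i μ z) - 2 ≤ θb * (((((ℓ + 1) ^ (blkOf i.D.toDomains (shiftY i μ z)).1.1 : ℕ) : ℝ)) ^ 2)⁻¹)
    (hs : ∀ z w : SiteY i, blkOf i.D.toDomains w = blkOf i.D.toDomains z → ω z / ω w + ω w / ω z - 2 ≤ θs)
    (hκ : ((d : ℝ) + 1) * θb + θs / 2 ≤ 1 / 16) (μ : Fin (d + 1))
    {A B : Finset (SiteY i)} {Λ : SiteY i → Matrix (Fin N) (Fin N) ℂ} (hv : ∀ z, z ∉ B → cdsS i U μ Λ z = 0) (hωB : ∀ z ∈ B, ω z = 1)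
    {W : ℝ} (hW0 : 0 < W) (hW : ∀ z ∈ A, W ≤ ω z) :
    ∑ z ∈ A, ∑ ν : Fin (d + 1), ∑ a, ∑ b, ‖cdS i U ν (GsqY i (parSymY i) D U (cdsS i U μ Λ)) z a b‖ ^ 2
      ≤ 10 * trIP (fun _ => (1 : ℝ)) Λ Λ / W ^ 2 := by
  have hU : ∀ μ x, U μ x ∈ G := hreg.1
  have hθ : ((d : ℝ) + 1) * θb ≤ 1 / 16 := by linarith
  have hθb1 : θb ≤ 1 / 16 := by
    have : (0 : ℝ) ≤ d := Nat.cast_nonneg d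
    nlinarith
  set v := cdsS i U μ Λ with hvdef
  have hM0 : 0 ≤ ∑ z : SiteY i, (((((ℓ + 1) ^ (blkOf i.D.toDomains z).1.1 : ℕ) : ℝ)) ^ 2)⁻¹ * ∑ a, ∑ b, ‖(((ω z : ℝ) : ℂ) • GsqY i (parSymY i) D U v z) a b‖ ^ 2 :=
    Finset.sum_nonneg fun z _ => mul_nonneg (inv_nonneg.2 (by positivity)) (hs_nonneg _)
  -- Agmon's first reading with the source `v`: `c₀ M ≤ X = ⟨Φ, v⟩`
  have hiX := levelMass_wsmul_GsqY_le_pairing i hG hC0 hC1 hreg D hω hb1 hb2 hs hv hωB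
  -- `X ≤ ‖λ‖²`: `X = ⟨∇_μΦ, λ⟩ ≤ ‖∇_μΦ‖‖λ‖` and `‖∇_μΦ‖² ≤ Σ_ν‖∇_νΦ‖² ≤ X`
  have hQ0 : 0 ≤ trIP (fun _ => (1 : ℝ)) Λ Λ := trIP_self_nonneg _ (fun _ => one_pos) Λ
  have hΔΦ := trIP_GsqY_deltaPrimeAY_GsqY i hG hU D v
  have hXeq : trIP (fun _ => (1 : ℝ)) (GsqY i (parSymY i) D U v) v = trIP (fun _ => (1 : ℝ)) (cdS i U μ (GsqY i (parSymY i) D U v)) Λ := by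
    rw [hvdef, trIP_cdS_left i (fun μ x => hG (hU μ x)) μ]
  have hE0 : ∑ ν : Fin (d + 1), trIP (fun _ => (1 : ℝ)) (cdS i U ν (GsqY i (parSymY i) D U v)) (cdS i U ν (GsqY i (parSymY i) D U v))
      ≤ trIP (fun _ => (1 : ℝ)) (GsqY i (parSymY i) D U v) v := by
    have h := sum_trIP_cdS_le_trIP_deltaPrimeAY i hG (parSymY i) U (parSymY_inv_symm U) (fun z w => parSymY_mem i hU z w) hU (GsqY i (parSymY i) D U v)
    rwa [hΔΦ] at h
  have hXQ : trIP (fun _ => (1 : ℝ)) (GsqY i (parSymY i) D U v) v ≤ trIP (fun _ => (1 : ℝ)) Λ Λ := by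
    set X := trIP (fun _ => (1 : ℝ)) (GsqY i (parSymY i) D U v) v with hX
    have hX0 : 0 ≤ X := le_trans (Finset.sum_nonneg fun _ _ => trIP_self_nonneg _ (fun _ => one_pos) _) hE0
    have hcs := trIP_sq_le (fun _ => (1 : ℝ)) (fun _ => one_pos) (cdS i U μ (GsqY i (parSymY i) D U v)) Λ
    have hμ : trIP (fun _ => (1 : ℝ)) (cdS i U μ (GsqY i (parSymY i) D U v)) (cdS i U μ (GsqY i (parSymY i) D U v)) ≤ X :=
      le_trans (Finset.single_le_sum (f := fun ν => trIP (fun _ => (1 : ℝ)) (cdS i U ν (GsqY i (parSymY i) D U v)) (cdS i U ν (GsqY i (parSymY i) D U v)))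
        (fun _ _ => trIP_self_nonneg _ (fun _ => one_pos) _) (Finset.mem_univ μ)) hE0
    have h3 : X ^ 2 ≤ X * trIP (fun _ => (1 : ℝ)) Λ Λ := by
      rw [hXeq]; rw [hXeq] at hμ
      exact hcs.trans (mul_le_mul_of_nonneg_right hμ hQ0)
    rcases hX0.eq_or_lt with h0 | hpos
    · rw [← h0]; exact hQ0
    · have h4 : X * X ≤ trIP (fun _ => (1 : ℝ)) Λ Λ * X := by nlinarith
      exact le_of_mul_le_mul_right h4 hpos
  -- the energy of the weighted field
  have hE : ∑ ν : Fin (d + 1), trIP (fun _ => (1 : ℝ)) (cdS i U ν (fun w => ((ω w : ℝ) : ℂ) • GsqY i (parSymY i) D U v w))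
        (cdS i U ν (fun w => ((ω w : ℝ) : ℂ) • GsqY i (parSymY i) D U v w))
      ≤ trIP (fun _ => (1 : ℝ)) (GsqY i (parSymY i) D U v) v + (((d : ℝ) + 1) * θb + θs / 2) *
          ∑ z : SiteY i, (((((ℓ + 1) ^ (blkOf i.D.toDomains z).1.1 : ℕ) : ℝ)) ^ 2)⁻¹ * ∑ a, ∑ b, ‖(((ω z : ℝ) : ℂ) • GsqY i (parSymY i) D U v z) a b‖ ^ 2 := by
    have h1 := sum_trIP_cdS_le_trIP_deltaPrimeAY i hG (parSymY i) U (parSymY_inv_symm U) (fun z w => parSymY_mem i hU z w) hU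
      (fun w => ((ω w : ℝ) : ℂ) • GsqY i (parSymY i) D U v w)
    have h2 := trIP_wsmul_deltaPrimeAY_winv_ge i hG (parSymY i) U (parSymY_inv_symm U) (fun z w => parSymY_mem i hU z w) hU hω hb1 hb2 hs
      (fun w => ((ω w : ℝ) : ℂ) • GsqY i (parSymY i) D U v w)
    rw [conj_wsmul_GsqY_eq_pairing i hG hU D hω hv hωB] at h2
    linarith
  have hsum := sum_wsq_hs_cdS_le i hG hU hω hθb0 hθb1 hb2 (GsqY i (parSymY i) D U v)
  -- restrict to `A`
  have hPA : W ^ 2 * ∑ z ∈ A, ∑ ν : Fin (d + 1), ∑ a, ∑ b, ‖cdS i U ν (GsqY i (parSymY i) D U v) z a b‖ ^ 2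
      ≤ ∑ z : SiteY i, ∑ ν : Fin (d + 1), ω z ^ 2 * ∑ a, ∑ b, ‖cdS i U ν (GsqY i (parSymY i) D U v) z a b‖ ^ 2 := by
    rw [Finset.mul_sum]
    have hterm : ∀ z, 0 ≤ ∑ ν : Fin (d + 1), ω z ^ 2 * ∑ a, ∑ b, ‖cdS i U ν (GsqY i (parSymY i) D U v) z a b‖ ^ 2 :=
      fun z => Finset.sum_nonneg fun _ _ => mul_nonneg (sq_nonneg _) (hs_nonneg _)
    refine le_trans (Finset.sum_le_sum fun z hz => ?_) (Finset.sum_le_univ_sum_of_nonneg hterm)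
    rw [Finset.mul_sum]
    exact Finset.sum_le_sum fun _ _ => mul_le_mul_of_nonneg_right (pow_le_pow_left₀ hW0.le (hW z hz) 2) (hs_nonneg _)
  exact graddiv_arith hE hsum hPA hκ hθ hiX hXQ hM0 hW0

/-- ★★★ **(3.46e) WITH THE CANONICAL AGMON WEIGHT** `e^{δ₀ρ}`, `δ₀ = 1∕(4(d+2))` (`ρ` bond-Lipschitz at scale `(L^{lev})⁻¹`, block oscillation `≤ d+1`, `ρ = 0` on
`B ⊇ supp ∇\*_{U,μ}λ`, `ρ ≥ r` on `A`): `Σ_{z∈A}Σ_ν HS((∇_{U,ν}G′_□(U)∇\*_{U,μ}λ)(z)) ≤ 10·‖λ‖²₁∕(e^{δ₀r})²`.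
[cite: Balaban1985BackgroundPropagators, Cor 3.6 p.408, Thm 3.1 (3.46) p.398, (3.79) p.406; Agmon1982, Ch.1, Thm 1.5] -/
theorem hs_restrict_cdS_GsqY_cdsS_le_exp_canonical [Nonempty (Fin N)] (hG : G ≤ B7Prop2Explicit.unitaryUnits (Matrix (Fin N) (Fin N) ℂ))
    {U : CfgY (Matrix (Fin N) (Fin N) ℂ) i} {c α₀ : ℝ} (hC0 : 0 ≤ c * (kGeo i).M * α₀) (hC1 : c * (kGeo i).M * α₀ * ((d : ℝ) + 1) ≤ 1 / 16)
    (hreg : (bg9K (Matrix (Fin N) (Fin N) ℂ) G i).Reg335 c α₀ U) (D : Finset (SiteY i)) {ρ : SiteY i → ℝ}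
    (hρ1 : ∀ μ z, |ρ (shiftY i μ z) - ρ z| ≤ ((((ℓ + 1) ^ (blkOf i.D.toDomains z).1.1 : ℕ) : ℝ))⁻¹)
    (hρ2 : ∀ μ z, |ρ (shiftY i μ z) - ρ z| ≤ ((((ℓ + 1) ^ (blkOf i.D.toDomains (shiftY i μ z)).1.1 : ℕ) : ℝ))⁻¹)
    (hρD : ∀ z w : SiteY i, blkOf i.D.toDomains w = blkOf i.D.toDomains z → |ρ z - ρ w| ≤ (d : ℝ) + 1) (μ : Fin (d + 1))
    {A B : Finset (SiteY i)} {Λ : SiteY i → Matrix (Fin N) (Fin N) ℂ} (hv : ∀ z, z ∉ B → cdsS i U μ Λ z = 0) (hρB : ∀ z ∈ B, ρ z = 0)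
    {r : ℝ} (hr : ∀ z ∈ A, r ≤ ρ z) :
    ∑ z ∈ A, ∑ ν : Fin (d + 1), ∑ a, ∑ b, ‖cdS i U ν (GsqY i (parSymY i) D U (cdsS i U μ Λ)) z a b‖ ^ 2
      ≤ 10 * trIP (fun _ => (1 : ℝ)) Λ Λ / Real.exp ((1 / (4 * ((d : ℝ) + 2))) * r) ^ 2 := by
  have hd0 : (0 : ℝ) ≤ d := Nat.cast_nonneg d
  have hd2 : (0 : ℝ) < 4 * ((d : ℝ) + 2) := by positivity
  have hδ0 : (0 : ℝ) ≤ 1 / (4 * ((d : ℝ) + 2)) := by positivity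
  have hδ1 : 1 / (4 * ((d : ℝ) + 2)) ≤ 1 := by rw [div_le_one hd2]; linarith
  have hδD : 1 / (4 * ((d : ℝ) + 2)) * ((d : ℝ) + 1) ≤ 1 := by
    rw [div_mul_eq_mul_div, one_mul, div_le_one hd2]; linarith
  have hδκ0 : (1 / (4 * ((d : ℝ) + 2))) ^ 2 * (2 * ((d : ℝ) + 1) + ((d : ℝ) + 1) ^ 2) ≤ 1 / 16 := by
    rw [div_pow, one_pow, mul_pow, one_div_mul_eq_div, div_le_iff₀ (by positivity)]
    nlinarith
  have hδκ : ((d : ℝ) + 1) * (2 * (1 / (4 * ((d : ℝ) + 2))) ^ 2) + (2 * (1 / (4 * ((d : ℝ) + 2))) ^ 2 * ((d : ℝ) + 1) ^ 2) / 2 ≤ 1 / 16 := by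
    have e : ((d : ℝ) + 1) * (2 * (1 / (4 * ((d : ℝ) + 2))) ^ 2) + (2 * (1 / (4 * ((d : ℝ) + 2))) ^ 2 * ((d : ℝ) + 1) ^ 2) / 2
        = (1 / (4 * ((d : ℝ) + 2))) ^ 2 * (2 * ((d : ℝ) + 1) + ((d : ℝ) + 1) ^ 2) := by ring
    rw [e]; exact hδκ0
  have hω : ∀ z, 0 < Real.exp (1 / (4 * ((d : ℝ) + 2)) * ρ z) := fun z => Real.exp_pos _
  have hωB : ∀ z ∈ B, Real.exp (1 / (4 * ((d : ℝ) + 2)) * ρ z) = 1 := fun z hz => by rw [hρB z hz, mul_zero, Real.exp_zero]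
  have hW : ∀ z ∈ A, Real.exp (1 / (4 * ((d : ℝ) + 2)) * r) ≤ Real.exp (1 / (4 * ((d : ℝ) + 2)) * ρ z) :=
    fun z hz => Real.exp_le_exp.2 (mul_le_mul_of_nonneg_left (hr z hz) hδ0)
  exact hs_restrict_cdS_GsqY_cdsS_le i hG hC0 hC1 hreg D hω (by positivity) (by positivity)
    (fun μ z => bondRatio_exp_le i hδ0 hδ1 μ z (hρ1 μ z)) (fun μ z => bondRatio_exp_le' i hδ0 hδ1 μ z (hρ2 μ z))
    (fun z w hzw => blockOsc_exp_le i hδ0 hδD z w (hρD z w hzw)) hδκ μ hv hωB (Real.exp_pos _) hW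

end Literature.MathematicalPhysics.QuantumFieldTheory.Balaban1983to89.B9Thm31SiteGsqGradDecayReg335Y
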